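import Literature.MathematicalPhysics.QuantumFieldTheory.Balaban1983to89.Node00.Sect2FrameOfRecord
import Literature.MathematicalPhysics.QuantumFieldTheory.Balaban1983to89.Node00.Record11
import Literature.MathematicalPhysics.QuantumFieldTheory.Balaban1983to89.T4LevelShift
import Literature.MathematicalPhysics.QuantumFieldTheory.Balaban1983to89.B10Eq27TorusAxialLog
import Literature.MathematicalPhysics.QuantumFieldTheory.Balaban1983to89.BlockAveragingEMLAnalyticMean
import Literature.MathematicalPhysics.QuantumFieldTheory.Balaban1983to89.BlockAveragingPlaquetteBoundLocal

/-!
# NODE 00 ∕ W1 — THE CONFIGURATION TRANSPORT OF RECORD run `k+1 → k` ON THE COMPLEX PAIR SPACE `Φ = (𝐔, 𝐉)`: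
# the (0.4) average of [Balaban1987RG1] continued to `Gᶜ`-valued fields («It is a Gᶜ-valued function … analytic», p. 253),
# followed by the level identification run `(k+1)`'s `T^{(1)}` = run `k`'s `T^{(0)}` — the INHABITANT of the displayed parameter
# `Tcfg : CPair (F.P (k+1)) (MatA N) → CPair (F.P k) (MatA N)` of W1-14 (`HistoryGermReading`) and of `TΦ`∕`Tcfg` of node N18's
# transport-clause reduction, with its two (T1) laws PROVED: `Tcfg ∘ embedPair = embedPair ∘ TΦ` and the background face
# `Tcfg (ιU, 0) = (ι(T₀U), 0)`, `T₀ = fieldShift ∘ avgFun expMeanLogSU` (the tree's transport of record `transportRaw F k (avOfRecord F N (k+1) 0)`).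

Seat `pub-ymgap-node00-def-W1` g23 (DEFINER, object W1 = [Balaban1988RG2Cluster] §2 (2.13)–(2.14): the older terms of the history are read on the
new torus's fields through a transport of configurations; Literature side, hypothesis-schema style, D-0064 one file per source section).

## The objects

* §1 **`avgUnits 𝐔`** — for a configuration `𝐔` with values in the units `𝔸ˣ` of a complete normed `ℂ`-algebra (`(MatA N)ˣ = GL(N, ℂ)` at the
  record): `Ū(c) = exp[|I|⁻¹ Σ_i log 𝐔(Γ ∪ [x,x′] ∪ (−Γ′) ∪ (−c))]·𝐔(c)` — the printed (0.4) with the printed `exp[mean log]` (`ExpMeanLog.eml`) of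
  the loop variables `loopVarU` (torus transports `B10Eq27TorusAxialLog.holT` along the words `BlockAveraging.loopWord` from the block centre) times
  the straight transporter `straightU` of `L` steps; NO small-field guard (the guard of `BlockAveraging.corr` is what makes the `SU(N)` map TOTAL; here
  the map is total because `eml` is, and it is the analytic continuation p. 253 asks for on `‖𝐔(loop) − 1‖ < 1`).  These are VERBATIM the bodies of the
  UnitScaleTilt pen's route-local Summit-side `Summit.QuantumFields.YangMills.Theorems.Prop8Chart.loopHolU`∕`emlAvgU` (`Theorems/UnitScaleTiltProp8ChartDefs`),
  which a Literature file cannot import: the identification `Prop8Chart.emlAvgU = W1.avgUnits` is `rfl` Summit-side, so that pen's exact covariance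
  `emlAvgU_gaugeActT` ((T2)'s `𝐔`-half, [Balaban1985Averaging] (11)) and its calculus apply to `avgUnits` unchanged.
* §2 **`avgAlg V`** — the SAME formula on `𝔸`-valued (not necessarily invertible) configurations, backward letters read through `Ring.inverse`
  (`holInv`): a TOTAL map `GaugeField P j 𝔸 → GaugeField P (j+1) 𝔸` agreeing with `avgUnits` on units-valued configurations (`avgAlg_val`) — the
  configuration space `Φ` of the tower (`Sect2.CPair`) carries `𝔸`-valued `𝐔`, and a transport on it must be a function there (NOT the injective
  extension of the background reading).
* §3 **the (T1) kernel on `SU(N)`** (`val_avgUnits_ιSU`, `avgUnits_ιSU`): on an `SU(N)`-valued field whose (0.4) loop variables at `c` are `δ_N`-small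
  (`BlockAveraging.Small expMeanLogSU U c` — the tree's guard), `avgUnits` of the field read through `ιSU : SU(N) →* (MatA N)ˣ` IS `ιSU` of the tree's
  `avgFun expMeanLogSU U` at `c` (the guard follows from a plaquette bound: [Balaban1985Averaging] Prop. 1, tree's `small_of_plaqSmallOn_blocks`).
* §4 **THE PAIR TRANSPORTS OF RECORD** at `𝔸 = MatA N` over the torus family `F`:
  `TΦOfRecord F N k : FieldPair (F.P (k+1)) 0 (MatA N)ˣ (MatA N) → FieldPair (F.P k) 0 (MatA N)ˣ (MatA N)`, `Φ ↦ (fieldShift (avgUnits Φ.U), 0)`, and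
  `TcfgOfRecord F N k : CPair (F.P (k+1)) (MatA N) → CPair (F.P k) (MatA N)`, `ψ ↦ (fieldShift (avgAlg ψ.1), 0)`, with
  **`TcfgOfRecord_embedPair`** (`Tcfg ∘ embedPair = embedPair ∘ TΦ`) and **`TcfgOfRecord_ofBackgroundC`** (the background face, under the guard at every
  coarse bond; `TcfgOfRecord_ofBackgroundC_of_plaqBound` from a plaquette bound `|U(∂q) − 1| < a`, `((d+2)L)²a/4 < δ_N`).

## The `𝐉`-slot (print check, [Balaban1987RG1] pp. 261–262)

Print transports NO `𝐉`-variable: `𝐉` is «the second variable replacing the functions (1.8)» (the special second-order derivative of the configuration),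
and the older tori's pairs are `(U_n(M(U)), J_n(M(U)))` ((1.15)) — BOTH functions of the gauge field.  The record reads every background at `𝐉 = 0`
(`Sect2.ofBackgroundC ι U = (ι ∘ U, 0)`; W1-14's face law `Tcfg (ιU, 0) = (ι(T₀U), 0)`), under which convention the (1.8)-slot is carried by the
`𝐔`-dependence of the terms; accordingly the transports of record RESET the `𝐉`-slot to `0`.  This choice is exactly covariant under (1.10)
(`R(u′)0 = 0`), satisfies (1.14)'s `|𝐉′| < γ₀` from `0 < γ₀` alone, and makes both (T1) laws free of `𝐉`-hypotheses.  (The block average `Q𝐉` is NOT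
(1.10)-covariant for block-varying `Gᶜ`-valued `u`; the covariant block average of [Balaban1985PropagatorsBackground] (3.19)∕(3.32) would be the other
exactly covariant choice — not needed by the record's reading.)

## What is NOT here (consumers' work, by name)

(T2) the `Gᶜ`-membership of the coarse transformation `u ∘ emb ∘ siteShift` and (T3) the transport of the conditions (1.11)–(1.14) (node N18 (β4)–(β5));
the analyticity of `TcfgOfRecord` on the pointwise-invertible locus (`Ring.inverse`, `eml` analytic on `‖W − 1‖ < 1`); any claim about the mass gap.
No `sorry`, no `instance`, no notation.

References: T. Bałaban, CMP **109** (1987) 249–301 [Balaban1987RG1] ((0.4)–(0.7) p.253, (1.8)–(1.10) pp.261–262, (1.15) p.262); CMP **116** (1988) 1–22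
[Balaban1988RG2Cluster] ((2.13)–(2.14) pp.14–15); CMP **98** (1985) 17–51 [Balaban1985Averaging] ((8)–(11) pp.18–19, Prop. 1 p.26).
-/

noncomputable section

open scoped BigOperators Matrix.Norms.L2Operator

namespace Literature.MathematicalPhysics.QuantumFieldTheory.Balaban1983to89.Node00.W1

open T4Continuum BlockAveraging ExpMeanLog MatrixLog B10Eq27TorusAxialLog T4LevelShift Sect2

/-! ## §1 The complexified (0.4) average on `𝔸ˣ`-valued configurations -/

section Units

variable {P : Params} {𝔸 : Type*} [NormedRing 𝔸] [NormedAlgebra ℂ 𝔸] [CompleteSpace 𝔸] {j : ℕ}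

omit [NormedAlgebra ℂ 𝔸] [CompleteSpace 𝔸] in
/-- The (0.4) LOOP VARIABLES `𝐔(Γ ∪ [x,x′] ∪ (−Γ′) ∪ (−c))` of an `𝔸ˣ`-valued configuration at the coarse bond `c`, index `i = (n, σ, σ′)`: the torus
transport along the loop word from the block centre `emb c₋` (body = UnitScaleTilt's `Prop8Chart.loopHolU`). [cite: Balaban1987RG1, (0.4) p.253] -/
def loopVarU (U : GaugeField P j 𝔸ˣ) (c : PBond P (j + 1)) (i : Idx P) : 𝔸ˣ :=
  holT U (emb c.src) (loopWord P.L c.dir (off i.1) i.2.1 i.2.2)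

omit [NormedAlgebra ℂ 𝔸] [CompleteSpace 𝔸] in
/-- The STRAIGHT TRANSPORTER `𝐔(c) = 𝐔(b₁)⋯𝐔(b_L)` of the coarse bond `c` (`L` forward steps from `emb c₋`). [cite: Balaban1987RG1, (0.4) p.253] -/
def straightU (U : GaugeField P j 𝔸ˣ) (c : PBond P (j + 1)) : 𝔸ˣ :=
  holT U (emb c.src) (List.replicate P.L (c.dir, true))

/-- **THE COMPLEXIFIED (0.4) AVERAGE** `Ū(c) = exp[|I|⁻¹ Σ_i log 𝐔(loop_i)]·𝐔(c)` on `𝔸ˣ`-valued configurations — the printed `exp[mean log]`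
(`ExpMeanLog.eml`, a unit by `isUnit_eml`) of the loop variables times the straight transporter; no small-field guard (body = UnitScaleTilt's
`Prop8Chart.emlAvgU`, so `Prop8Chart.emlAvgU = avgUnits` is `rfl` Summit-side). [cite: Balaban1987RG1, (0.4) p.253] -/
def avgUnits (U : GaugeField P j 𝔸ˣ) : GaugeField P (j + 1) 𝔸ˣ := fun c =>
  (isUnit_eml (fun i : Idx P => ((loopVarU U c i : 𝔸ˣ) : 𝔸))).unit * straightU U c

/-- The value of the averaged bond variable. [cite: Balaban1987RG1, (0.4) p.253] -/
theorem val_avgUnits (U : GaugeField P j 𝔸ˣ) (c : PBond P (j + 1)) :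
    ((avgUnits U c : 𝔸ˣ) : 𝔸) = eml (fun i : Idx P => ((loopVarU U c i : 𝔸ˣ) : 𝔸)) * ((straightU U c : 𝔸ˣ) : 𝔸) := by
  rw [avgUnits, Units.val_mul, IsUnit.unit_spec]

end Units

/-! ## §2 The same formula on `𝔸`-valued configurations (`Ring.inverse` on backward letters) -/

section Algebra

variable {P : Params} {𝔸 : Type*} [NormedRing 𝔸] {j : ℕ}

/-- Transport of an `𝔸`-valued configuration along the word `w` from `x`, backward letters read through `Ring.inverse` (`= ⁻¹` on units, `0` off them):
the total extension of `B10Eq27TorusAxialLog.holT` from `𝔸ˣ`- to `𝔸`-valued configurations. [cite: Balaban1985Averaging, (9) p.18] -/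
def holInv (V : GaugeField P j 𝔸) : Site P j → List (Letter P.d) → 𝔸
  | _, [] => 1
  | x, (μ, true) :: w => V ⟨x, μ⟩ * holInv V (x.shift μ) w
  | x, (μ, false) :: w => Ring.inverse (V ⟨x.unshift μ, μ⟩) * holInv V (x.unshift μ) w

/-- `V(∅) = 1` (bookkeeping of (9)). [cite: Balaban1985Averaging, (9) p.18] -/
@[simp] theorem holInv_nil (V : GaugeField P j 𝔸) (x : Site P j) : holInv V x [] = 1 := rfl

/-- a forward letter contributes `V(x, x+e_μ)` (bookkeeping of (9)). [cite: Balaban1985Averaging, (9) p.18] -/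
@[simp] theorem holInv_cons_true (V : GaugeField P j 𝔸) (x : Site P j) (μ : Fin P.d) (w : List (Letter P.d)) :
    holInv V x ((μ, true) :: w) = V ⟨x, μ⟩ * holInv V (x.shift μ) w := rfl

/-- a backward letter contributes `Ring.inverse (V(x−e_μ, x))` (bookkeeping of (9)). [cite: Balaban1985Averaging, (9) p.18] -/
@[simp] theorem holInv_cons_false (V : GaugeField P j 𝔸) (x : Site P j) (μ : Fin P.d) (w : List (Letter P.d)) :
    holInv V x ((μ, false) :: w) = Ring.inverse (V ⟨x.unshift μ, μ⟩) * holInv V (x.unshift μ) w := rfl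

/-- **On units-valued configurations `holInv` IS `holT`** (read in `𝔸`). [cite: Balaban1985Averaging, (9) p.18] -/
theorem holInv_val (U : GaugeField P j 𝔸ˣ) : ∀ (x : Site P j) (w : List (Letter P.d)),
    holInv (fun b => ((U b : 𝔸ˣ) : 𝔸)) x w = ((holT U x w : 𝔸ˣ) : 𝔸)
  | x, [] => by rw [holInv_nil, holT_nil, Units.val_one]
  | x, (μ, true) :: w => by rw [holInv_cons_true, holT_cons_true, Units.val_mul, holInv_val U (x.shift μ) w]
  | x, (μ, false) :: w => by
    rw [holInv_cons_false, holT_cons_false, Units.val_mul, holInv_val U (x.unshift μ) w, Ring.inverse_unit]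

/-- The (0.4) loop variables of an `𝔸`-valued configuration. [cite: Balaban1987RG1, (0.4) p.253] -/
def loopVarAlg (V : GaugeField P j 𝔸) (c : PBond P (j + 1)) (i : Idx P) : 𝔸 :=
  holInv V (emb c.src) (loopWord P.L c.dir (off i.1) i.2.1 i.2.2)

/-- The straight transporter of an `𝔸`-valued configuration. [cite: Balaban1987RG1, (0.4) p.253] -/
def straightAlg (V : GaugeField P j 𝔸) (c : PBond P (j + 1)) : 𝔸 :=
  holInv V (emb c.src) (List.replicate P.L (c.dir, true))

/-- On units-valued configurations the loop variables are those of §1. [cite: Balaban1987RG1, (0.4) p.253] -/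
theorem loopVarAlg_val (U : GaugeField P j 𝔸ˣ) (c : PBond P (j + 1)) (i : Idx P) :
    loopVarAlg (fun b => ((U b : 𝔸ˣ) : 𝔸)) c i = ((loopVarU U c i : 𝔸ˣ) : 𝔸) :=
  holInv_val U _ _

/-- On units-valued configurations the straight transporter is that of §1. [cite: Balaban1987RG1, (0.4) p.253] -/
theorem straightAlg_val (U : GaugeField P j 𝔸ˣ) (c : PBond P (j + 1)) :
    straightAlg (fun b => ((U b : 𝔸ˣ) : 𝔸)) c = ((straightU U c : 𝔸ˣ) : 𝔸) :=
  holInv_val U _ _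

variable [NormedAlgebra ℂ 𝔸]

/-- **THE COMPLEXIFIED (0.4) AVERAGE AS A TOTAL MAP ON `𝔸`-VALUED CONFIGURATIONS** `V ↦ exp[|I|⁻¹ Σ_i log V(loop_i)]·V(c)` (loops through
`Ring.inverse`): the configuration-space map behind `TcfgOfRecord`. [cite: Balaban1987RG1, (0.4) p.253] -/
def avgAlg (V : GaugeField P j 𝔸) : GaugeField P (j + 1) 𝔸 := fun c =>
  eml (fun i : Idx P => loopVarAlg V c i) * straightAlg V c

/-- `avgAlg` unfolded at a coarse bond. [cite: Balaban1987RG1, (0.4) p.253] -/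
theorem avgAlg_apply (V : GaugeField P j 𝔸) (c : PBond P (j + 1)) :
    avgAlg V c = eml (fun i : Idx P => loopVarAlg V c i) * straightAlg V c := rfl

/-- **`avgAlg` EXTENDS `avgUnits`**: on a units-valued configuration read in `𝔸`, `avgAlg` is the value of `avgUnits`. [cite: Balaban1987RG1, (0.4) p.253] -/
theorem avgAlg_val [CompleteSpace 𝔸] (U : GaugeField P j 𝔸ˣ) (c : PBond P (j + 1)) :
    avgAlg (fun b => ((U b : 𝔸ˣ) : 𝔸)) c = ((avgUnits U c : 𝔸ˣ) : 𝔸) := by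
  rw [avgAlg_apply, val_avgUnits, straightAlg_val]
  congr 1
  congr 1
  funext i
  exact loopVarAlg_val U c i

end Algebra

/-! ## §3 The (T1) kernel on `SU(N)`: on the tree's guard, `avgUnits ∘ ιSU = ιSU ∘ avgFun expMeanLogSU` -/

section Kernel

variable {P : Params} {N : ℕ} [NeZero N] {j : ℕ}

/-- The loop variables of an `SU(N)` field read through `ιSU` are the tree's (0.4) loop variables (`BlockAveraging.loopHol`) as matrices.
[cite: Balaban1987RG1, (0.4) p.253] -/
theorem val_loopVarU_ιSU (U : GaugeField P j (SU N)) (c : PBond P (j + 1)) (i : Idx P) :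
    ((loopVarU (fun b => ιSU N (U b)) c i : (MatA N)ˣ) : MatA N) = ((loopHol U c i : SU N) : MatA N) := by
  rw [loopVarU, holT_map, coe_ιSU, holT_eq_holAt]
  rfl

/-- The straight transporter of an `SU(N)` field read through `ιSU` is the tree's `AveragingRT.axialAvg` as a matrix. [cite: Balaban1987RG1, (0.4) p.253] -/
theorem val_straightU_ιSU (U : GaugeField P j (SU N)) (c : PBond P (j + 1)) :
    ((straightU (fun b => ιSU N (U b)) c : (MatA N)ˣ) : MatA N) = ((AveragingRT.axialAvg U c : SU N) : MatA N) := by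
  rw [straightU, holT_map, coe_ιSU, holT_eq_holAt, ← axialAvg_eq_holAt_walk]

/-- **(T1) KERNEL, MATRIX FORM**: for an `SU(N)` field whose (0.4) loop variables at `c` are `δ_N`-small (the tree's guard `Small expMeanLogSU U c`),
the matrix of `avgUnits (ιSU ∘ U)` at `c` IS the matrix of the tree's `avgFun expMeanLogSU U` at `c` — on the guard the tree's correction factor is
`exp[mean log]` of the loop variables (`coe_expMeanLogSU_E_eq_eml`), read in any enumeration of the index set. [cite: Balaban1987RG1, (0.4) p.253] -/
theorem val_avgUnits_ιSU (U : GaugeField P j (SU N)) (c : PBond P (j + 1)) (hsmall : Small (expMeanLogSU (n := Fin N)) U c) :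
    ((avgUnits (fun b => ιSU N (U b)) c : (MatA N)ˣ) : MatA N) = ((avgFun (expMeanLogSU (n := Fin N)) U c : SU N) : MatA N) := by
  rw [val_avgUnits]
  have hloop : (fun i : Idx P => ((loopVarU (fun b => ιSU N (U b)) c i : (MatA N)ˣ) : MatA N)) =
      fun i => ((loopHol U c i : SU N) : MatA N) := by
    funext i; exact val_loopVarU_ιSU U c i
  rw [hloop, val_straightU_ιSU]
  have havg : avgFun (expMeanLogSU (n := Fin N)) U c = corr (expMeanLogSU (n := Fin N)) U c * AveragingRT.axialAvg U c := rfl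
  rw [havg, Submonoid.coe_mul]
  congr 1
  unfold corr
  rw [if_pos hsmall]
  unfold LoopAverage.avg
  rw [BlockAveragingEMLAnalyticMean.coe_expMeanLogSU_E_eq_eml (loopHol U c ∘ ⇑(LoopAverage.enum (Idx P)).symm) (fun i => hsmall _)]
  -- `eml` does not depend on the enumeration of the index set
  have hre : ∀ (W : Idx P → MatA N), eml (W ∘ ⇑(LoopAverage.enum (Idx P)).symm) = eml W := by
    intro W
    rw [eml_eq_exp, eml_eq_exp, Fintype.card_congr (LoopAverage.enum (Idx P)).symm]
    simp only [Function.comp_apply]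
    rw [Equiv.sum_comp (LoopAverage.enum (Idx P)).symm (fun i => mlog (W i))]
  exact (hre (fun i : Idx P => ((loopHol U c i : SU N) : MatA N))).symm

/-- **(T1) KERNEL**: on the guard, `avgUnits (ιSU ∘ U) c = ιSU (avgFun expMeanLogSU U c)`. [cite: Balaban1987RG1, (0.4) p.253] -/
theorem avgUnits_ιSU (U : GaugeField P j (SU N)) (c : PBond P (j + 1)) (hsmall : Small (expMeanLogSU (n := Fin N)) U c) :
    avgUnits (fun b => ιSU N (U b)) c = ιSU N (avgFun (expMeanLogSU (n := Fin N)) U c) :=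
  Units.ext (by rw [val_avgUnits_ιSU U c hsmall, coe_ιSU])

end Kernel

/-! ## §4 The pair transports of record run `k+1 → k` at `𝔸 = MatA N` -/

section Record

variable (F : T4Family) (N : ℕ) (k : ℕ)

/-- **THE UNITS-LEVEL PAIR TRANSPORT OF RECORD** `TΦ : (𝐔, 𝐉) ↦ (Ū read on run k's unit lattice, 0)`: the complexified (0.4) average of the
`GL(N,ℂ)`-valued gauge field on run `(k+1)`'s finest lattice, identified with a configuration on run `k`'s finest lattice (`fieldShift`, run `(k+1)`'s
level `1` = run `k`'s level `0`), and the `𝐉`-slot reset to the record's background value `0` (module docstring, «The 𝐉-slot»).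
[cite: Balaban1987RG1, (0.4) p.253 and (1.15) p.262; Balaban1988RG2Cluster, (2.13) p.14] -/
def TΦOfRecord (Φ : FieldPair (F.P (k + 1)) 0 (MatA N)ˣ (MatA N)) : FieldPair (F.P k) 0 (MatA N)ˣ (MatA N) where
  U := fieldShift (sitesPerDir_ladder F (K := k) (j := 0) rfl rfl) (avgUnits Φ.U)
  J := fun _ => 0

/-- **THE CONFIGURATION TRANSPORT OF RECORD ON `Φ`** `Tcfg : (𝐔, 𝐉) ↦ (avgAlg 𝐔 read on run k's unit lattice, 0)` — a TOTAL map on the complex pair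
space `Sect2.CPair` (the inhabitant of W1-14's parameter `Tcfg`). [cite: Balaban1987RG1, (0.4) p.253 and (1.15) p.262; Balaban1988RG2Cluster, (2.13) p.14] -/
def TcfgOfRecord (ψ : CPair (F.P (k + 1)) (MatA N)) : CPair (F.P k) (MatA N) :=
  (fieldShift (sitesPerDir_ladder F (K := k) (j := 0) rfl rfl) (avgAlg ψ.1), fun _ => 0)

variable {F N k}

/-- `TΦ`'s gauge-field component at a bond. [cite: Balaban1987RG1, (0.4) p.253] -/
@[simp] theorem TΦOfRecord_U (Φ : FieldPair (F.P (k + 1)) 0 (MatA N)ˣ (MatA N)) (b : PBond (F.P k) 0) :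
    (TΦOfRecord F N k Φ).U b = avgUnits Φ.U (bondShift (sitesPerDir_ladder F (K := k) (j := 0) rfl rfl) b) := rfl

/-- `TΦ`'s `𝐉`-component is `0`. [cite: Balaban1987RG1, (1.15) p.262] -/
@[simp] theorem TΦOfRecord_J (Φ : FieldPair (F.P (k + 1)) 0 (MatA N)ˣ (MatA N)) (b : PBond (F.P k) 0) :
    (TΦOfRecord F N k Φ).J b = 0 := rfl

/-- `Tcfg`'s gauge-field component at a bond. [cite: Balaban1987RG1, (0.4) p.253] -/
@[simp] theorem TcfgOfRecord_fst (ψ : CPair (F.P (k + 1)) (MatA N)) (b : PBond (F.P k) 0) :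
    (TcfgOfRecord F N k ψ).1 b = avgAlg ψ.1 (bondShift (sitesPerDir_ladder F (K := k) (j := 0) rfl rfl) b) := rfl

/-- `Tcfg`'s `𝐉`-component is `0`. [cite: Balaban1987RG1, (1.15) p.262] -/
@[simp] theorem TcfgOfRecord_snd (ψ : CPair (F.P (k + 1)) (MatA N)) (b : PBond (F.P k) 0) :
    (TcfgOfRecord F N k ψ).2 b = 0 := rfl

/-- **(T1), COMPATIBILITY: `Tcfg ∘ embedPair = embedPair ∘ TΦ`** — on units-valued pairs read in `Φ` the configuration transport is the units-level
transport (hypothesis `hcompat` of node N18's transport-clause reduction). [cite: Balaban1987RG1, (1.9)-(1.10) p.262; Balaban1988RG2Cluster, (2.13) p.14] -/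
theorem TcfgOfRecord_embedPair (Ψ : FieldPair (F.P (k + 1)) 0 (MatA N)ˣ (MatA N)) :
    TcfgOfRecord F N k (embedPair Ψ) = embedPair (TΦOfRecord F N k Ψ) := by
  refine Prod.ext ?_ rfl
  funext b
  exact avgAlg_val Ψ.U _

/-- Non-vacuity: the flat units-valued pair `(1, 0)` is transported to the flat pair — every loop variable is `1`, `eml 1 = 1`, the straight transporter is `1`.
[cite: Balaban1987RG1, (0.4) p.253] -/
theorem TcfgOfRecord_one :
    TcfgOfRecord F N k ((fun _ => 1, fun _ => 0) : CPair (F.P (k + 1)) (MatA N)) = (fun _ => 1, fun _ => 0) := by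
  have h1 : ((fun _ => 1, fun _ => 0) : CPair (F.P (k + 1)) (MatA N)) = embedPair ⟨fun _ => 1, fun _ => 0⟩ := by
    refine Prod.ext ?_ rfl
    funext b
    rfl
  rw [h1, TcfgOfRecord_embedPair]
  refine Prod.ext ?_ rfl
  funext b
  show ((avgUnits (fun _ : PBond (F.P (k + 1)) 0 => (1 : (MatA N)ˣ)) _ : (MatA N)ˣ) : MatA N) = 1
  rw [val_avgUnits]
  have hl : (fun i : Idx (F.P (k + 1)) => ((loopVarU (fun _ : PBond (F.P (k + 1)) 0 => (1 : (MatA N)ˣ)) (bondShift (sitesPerDir_ladder F (K := k) (j := 0) rfl rfl) b) i :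
      (MatA N)ˣ) : MatA N)) = fun _ => 1 := by
    funext i
    rw [loopVarU, B10Eq27TorusAxialLog.holT_one, Units.val_one]
  rw [hl, straightU, B10Eq27TorusAxialLog.holT_one, Units.val_one, mul_one, eml_eq_exp]
  simp [mlog_one, NormedSpace.exp_zero]

variable [NeZero N]

/-- **(T1), THE BACKGROUND FACE: `Tcfg (ιU, 0) = (ι(T₀U), 0)`** with `T₀U = fieldShift (avgFun expMeanLogSU U)` — by `rfl` the tree's transport of
record `transportRaw F k (avOfRecord F N (k+1) 0) U` — for every `SU(N)`-valued background whose (0.4) loop variables are `δ_N`-small at every coarse bond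
(hypothesis `hface` of node N18's reduction; W1-14's `hTcfg`). [cite: Balaban1987RG1, (0.4) p.253; Balaban1988RG2Cluster, (2.13)-(2.14) pp.14-15] -/
theorem TcfgOfRecord_ofBackgroundC (U : GaugeField (F.P (k + 1)) 0 (SU N)) (hsmall : ∀ c, Small (expMeanLogSU (n := Fin N)) U c) :
    TcfgOfRecord F N k (ofBackgroundC (ιSU N) U) =
      ofBackgroundC (ιSU N) (fieldShift (sitesPerDir_ladder F (K := k) (j := 0) rfl rfl) (avgFun (expMeanLogSU (n := Fin N)) U)) := by
  refine Prod.ext ?_ rfl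
  funext b
  exact (avgAlg_val (fun b' => ιSU N (U b')) _).trans (congrArg (fun g : (MatA N)ˣ => (g : MatA N)) (avgUnits_ιSU U _ (hsmall _)))

/-- **THE BACKGROUND FACE FROM A PLAQUETTE BOUND**: if every plaquette variable of `U` is within `a` of `1` and `((d+2)L)²a/4 < δ_N` (`= 9L²a` at `d = 4`),
then the guard holds at every coarse bond ([Balaban1985Averaging] Prop. 1 in the tree's local form `small_of_plaqSmallOn_blocks`) and
`Tcfg (ιU, 0) = (ι(T₀U), 0)`. [cite: Balaban1987RG1, (0.4) p.253; Balaban1985Averaging, (51) p.26] -/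
theorem TcfgOfRecord_ofBackgroundC_of_plaqBound (U : GaugeField (F.P (k + 1)) 0 (SU N)) {a : ℝ} (ha : 0 ≤ a)
    (hU : ∀ q : Plaq (F.P (k + 1)) 0, dist1 (GaugeField.plaqHol U q) < a)
    (haδ : (((((F.P (k + 1)).d + 2) * (F.P (k + 1)).L : ℕ) : ℝ) ^ 2 / 4) * a < deltaSU (Fin N)) :
    TcfgOfRecord F N k (ofBackgroundC (ιSU N) U) =
      ofBackgroundC (ιSU N) (fieldShift (sitesPerDir_ladder F (K := k) (j := 0) rfl rfl) (avgFun (expMeanLogSU (n := Fin N)) U)) :=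
  TcfgOfRecord_ofBackgroundC U fun c =>
    BlockAveragingPlaquetteBoundLocal.small_of_plaqSmallOn_blocks (expMeanLogSU (n := Fin N)) ha
      (show 0 + 1 ≤ (F.P (k + 1)).m + (F.P (k + 1)).K by simp only [T4Family.P_m, T4Family.P_K]; omega) c (fun q _ => hU q) haδ

end Record

end Literature.MathematicalPhysics.QuantumFieldTheory.Balaban1983to89.Node00.W1

end
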